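/-
Copyright (c) 2026 the pub-hodgecm-mathlib formalisation cell (harness21).  Prover seat hodgecm-mathlib-F0P3a-p07 (g15) ((Cnt2′) chair): «S3-ram» seeding wave
(LEAD F0P3a-plan (g13); (α) block-law keeper F0P3a-p06 (g16)), organ «`stub_mdict`» = THE m ∕ N ∕ τ DICTIONARY of the (α) v1 block-law skeleton (chair RULING (13) (3)), PART 2∕2: the heads; 2026-09-02.
-/
import Literature.NumberTheory.Rogawski1990.DepthZeroKappaTransferTypeTwoRamifiedDepthParity   -- PART 1 (this seat): the trace∕parity law, Hensel bookkeeping; brings ★ p848151∕p848205 SignDictionary (B-p14), ★ DeepTauUniform, ★ RamifiedPlaceNormDictionary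
import HarnessLib

/-!
# The ramified type-(2) transfer: THE DEPTH DICTIONARY `m = min(v_w(2u_w − tr g_w), N)`, the PARITY LAW «`m < N ⇒ m` odd» and the SIGN per regime
# (Rogawski 1990 §4.9; Labesse–Langlands 1979 §2; Serre, *Local Fields* IV §2, V §3)

Topic `NumberTheory/Rogawski1990`; namespace `Literature.NumberTheory.Rogawski1990` (+ `.TypeTwoRamifiedDepth` for the generic lemmas).  THEOREMS ONLY (no definition, no
instance, no notation, no named fact, no `sorry`); kernel lane `--supports stmt-HodgeConjecture-24833`.  Cell `pub/hodgecm-mathlib` (D-0151), crux H413; road «S3-ram»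
(count-neutral), the (Cnt2′) block laws `stub_T2G_{zero,pm}_{even,odd}_block` (chair skeleton v4.3 ⟸ ★ p848712∕p848727) ⟸ (α) v1 `J0diff := rcases stub_mdict; rw [stub_Zhyp,
stub_Zaniso]; BlockLawArith.…` (keeper F0P3a-p06 (g16), closers ★ p849020 F0P3a-p03 (g18)).  THIS FILE IS `stub_mdict`: from the J0diff binders ALONE (`hblk hu2 hirr hdisc hn hm hβ`)
it derives the regime dictionary the branch split needs.

THE MATHEMATICS (`K = L_w`, `σ = σ_w`, `w ∣ v` tame ramified non-split, `ϖ` anti-fixed uniformiser; `g = g_w ∈ U(Φ₂)(K)` 2-deep with `t = tr g`, `δ = det g`, IRREDUCIBLE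
characteristic polynomial, `D = t² − 4δ`, `|D| = |ϖ|^{2N}`; `u = u_w`, `σu·u = 1`, 2-deep; `c = χ_g(u) = u² − tu + δ`, `|c| = |ϖ|^{2m}`; `x := 2u − t`; `ι_w β = −c(u² + δ)∕(2u²δ)`,
`τ := (β, θ)_v`).  Unitarity gives `σ(δ)δ = 1` and `σ(t)δ = t` (★ `galAdicCompletionMap_{det_mul_det_eq_one,trace_mul_det_eq}`), hence the EXACT identity
**`σ(x)·uδ + x = 2·det(g − 1) − (t − 2)(u − 1)`** and **`D = −(t − 2)·x − 2·(2·det(g − 1) − (t − 2)(u − 1))`** (`det(g − 1) = δ − t + 1`).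
* (PART 1, file `…DepthParity`) §1 `valued_map_sub_lt_of_valued_eq_pow_two_mul` — RESIDUAL PARITY at a tame ramified place: `|x| = |ϖ|^{2k}` ⇒ `|σx − x| < |x|` (`σ` is trivial on the residue field,
  `σ(ϖ^{2k}) = ϖ^{2k}`).  `valued_trace_sq_sub_four_det_eq_of_valued_map_sub_lt` — **THE TRACE LAW**: if `|σx − x| < |x|` then `|D| = |x|` (the identity above: `|uδ − 1| < 1`
  makes `|2det(g−1) − (t−2)(u−1)| = |2x| = |x|`, and `|t − 2| < 1`).  So an `x` of EVEN order has `|x| = |D|`: **`v(2u − t) < N ⇒ v(2u − t)` is ODD**, and `v(2u − t) = N` is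
  impossible for `N` even (`N ≥ 1`) — with no splitting field, no eigenvalues, no norm-one group.
* (PART 1) §2 bookkeeping at the CM place: `4c = x² − D` never cancels (`|x²| = |D|` and `|x² − D| < |D|` would make `D∕x²` a principal unit, a square by Hensel, against irreducibility:
  `not_isSquare_trace_sq_sub_four_det_of_not_exists_isRoot`, `isSquare_of_valued_sub_one_lt_one`, `valued_sq_sub_eq_of_not_isSquare`), and a non-square unit has non-square
  residue (`not_isSquare_residue_of_not_isSquare`).  Hence **`m = min(v(x), N)`**.
* §3 THE HEADS, in the J0diff's own binders: **`typeTwo_depthDictionary_even_ram`** (`N = 2n`): `m ≤ 2n`; `m < 2n → Odd m ∧ 3 ≤ m ∧ τ = 1 ∧ |2u_w − tr g_w| = |ϖ^m|`;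
  `m = 2n → τ = −1 ∧ |2u_w − tr g_w| < |ϖ^{2n}|` (regime B: `c ≡ (x∕2)²` to first order, a residue SQUARE, and `(−1)^{m+1} = 1`; regime A-even: `c ≡ −D∕4`, and `D∕ϖ^{2N}` is a
  residue NON-square; both read through ★ `quadraticChar_residue_eq_hilbertSymbol_typeTwo_of_sub_lt`).  **`typeTwo_depthDictionary_odd_ram`** (`N = 2n+1`): `m ≤ 2n+1`; the same
  regime-B clause; `m = 2n+1 → (τ = 1 ∨ τ = −1) ∧ |2u_w − tr g_w| ≤ |ϖ^{2n+1}|`.  ENGINE (B-p14 (g40) census, F0P3a-p03 (g18) REGIME TABLE v1): `V = m = min(N, d_u)` 164∕164,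
  `τ = +1` on all 57 regime-B rows, `τ = −1` on all 66 A-even rows.
HONEST LABEL: HC_CM is proved only modulo the 2 remaining named inputs (hLiu418 24832, h413 24833) until rung 0 closes; unconditional local algebra at one place, count-neutral.

## References
* [Rogawski1990] J. D. Rogawski, *Automorphic Representations of Unitary Groups in Three Variables*, Ann. of Math. Stud. 123 (1990), §4.9 pp. 54–56, 59 (the type-(2)
  ramified transfer: the depth `m`, the discriminant depth `N`, the sign `τ`).
* [LabesseLanglands1979] J.-P. Labesse, R. P. Langlands, *L-indistinguishability for SL(2)*, Canad. J. Math. 31 (1979), §2 pp. 8–9.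
* [Serre1979] J.-P. Serre, *Local Fields*, GTM 67 (1979), Ch. IV §2 Prop. 5 (tame ramified quadratic: `σ` trivial on the residue field), Ch. V §3 Cor. 2, Ch. II §4 Prop. 7 (Hensel).
-/

set_option autoImplicit false

noncomputable section

open NumberField IsDedekindDomain ValuativeRel Matrix Polynomial
open Literature.NumberTheory.Automorphic Literature.NumberTheory.Automorphic.UnitaryGroup Literature.NumberTheory.QuadraticForms
open Literature.NumberTheory.GaloisRepresentations (HeckeCharacter)
open scoped ValuativeRel MatrixGroups

namespace Literature.NumberTheory.Rogawski1990

/-! ## §3 The dictionary at the CM place -/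

section Dictionary

variable (L : Type) [Field L] [NumberField L] [IsCMField L] {v : HeightOneSpectrum (𝓞 ↥(maximalRealSubfield L))}
  (w : PlacesOver L v) (hw : IsCMField.complexConj L • w.1 = w.1)

include hw in
/-- **THE DEPTH DICTIONARY, CORE** (abstract carriers `u, t, δ, c` at the CM place `w`): with `σu·u = 1`, `σt·δ = t`, `|u − 1|, |t − 2| ≤ |ϖ²|`, `|δ − 1| < 1`,
`c = u² − tu + δ`, `D = t² − 4δ` NOT a square, `|D| = exp(−2N)`, `|c| = |ι_w ϖ_v|^m`, `ι_w β = −c(u²+δ)∕(2u²δ)`: **`m ≤ N`**; **`m < N ⇒ m` odd, `m ≥ 3`, `(β,θ)_v = 1`,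
`|2u − t| = |ϖ^m|`**; **`m = N ⇒ |2u − t| ≤ |ϖ^N|`, `|2u − t| = |ϖ^N| ⇒ N` odd, and `|2u − t| < |ϖ^N|` with `N` even `⇒ (β,θ)_v = −1`**.
[cite: Rogawski1990, §4.9 pp. 55, 59] [cite: LabesseLanglands1979, §2 pp. 8–9] [cite: Serre1979, Ch. V §3 Cor. 2] -/
theorem typeTwo_depthDictionary_core (he : v.asIdeal.ramificationIdx' w.1.asIdeal ≠ 1) (h2 : IsUnit (2 : 𝒪[(w.1.adicCompletion L)]))
    (ϖ : w.1.adicCompletion L) (hϖ : Valued.v ϖ = WithZero.exp (-1 : ℤ)) (hσϖ : galAdicCompletionMap (L := L) (IsCMField.complexConj L) hw ϖ = -ϖ)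
    {u t δ c : w.1.adicCompletion L}
    (hu : galAdicCompletionMap (L := L) (IsCMField.complexConj L) hw u * u = 1)
    (ht : galAdicCompletionMap (L := L) (IsCMField.complexConj L) hw t * δ = t)
    (hu2 : Valued.v (u - 1) ≤ Valued.v (ϖ ^ 2)) (ht2 : Valued.v (t - 2) ≤ Valued.v (ϖ ^ 2)) (hδ1 : Valued.v (δ - 1) < 1)
    (hc : c = u ^ 2 - t * u + δ) (hD : ¬ IsSquare (t ^ 2 - 4 * δ))
    {N : ℕ} (hdisc : Valued.v (t ^ 2 - 4 * δ) = WithZero.exp (-((2 * N : ℕ) : ℤ)))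
    (m : ℕ) (hm : Valued.v c =
      Valued.v ((toPlace v w (HeckeCharacter.uniformizer ↥(maximalRealSubfield L) v : v.adicCompletion ↥(maximalRealSubfield L))) ^ m))
    (β : (v.adicCompletion ↥(maximalRealSubfield L))ˣ)
    (hβ : toPlace v w (β : v.adicCompletion ↥(maximalRealSubfield L)) = -(c * (u ^ 2 + δ)) / (2 * u ^ 2 * δ)) :
    m ≤ N ∧
    (m < N → Odd m ∧ 3 ≤ m ∧
      hilbertSymbol (v.adicCompletion ↥(maximalRealSubfield L)) (β : v.adicCompletion ↥(maximalRealSubfield L))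
        (algebraMap ↥(maximalRealSubfield L) _ ((cmQuadraticGenerator L : 𝓞 ↥(maximalRealSubfield L)) : ↥(maximalRealSubfield L))) = 1 ∧
      Valued.v (2 * u - t) = Valued.v (ϖ ^ m)) ∧
    (m = N → Valued.v (2 * u - t) ≤ Valued.v (ϖ ^ N) ∧ (Valued.v (2 * u - t) = Valued.v (ϖ ^ N) → Odd N) ∧
      (Valued.v (2 * u - t) < Valued.v (ϖ ^ N) → Even N →
        hilbertSymbol (v.adicCompletion ↥(maximalRealSubfield L)) (β : v.adicCompletion ↥(maximalRealSubfield L))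
          (algebraMap ↥(maximalRealSubfield L) _ ((cmQuadraticGenerator L : 𝓞 ↥(maximalRealSubfield L)) : ↥(maximalRealSubfield L))) = -1)) := by
  classical
  haveI : Fintype 𝓀[w.1.adicCompletion L] := Fintype.ofFinite _
  have h2v : Valued.v (2 : w.1.adicCompletion L) = 1 := (isUnit_two_integer_iff_valued_eq_one L w.1).1 h2
  have h20 : (2 : w.1.adicCompletion L) ≠ 0 := fun h => by rw [h, map_zero] at h2v; exact zero_ne_one h2v
  have h4v : Valued.v (4 : w.1.adicCompletion L) = 1 := by
    rw [show (4 : w.1.adicCompletion L) = 2 * 2 by norm_num, map_mul, h2v, one_mul]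
  have h40 : (4 : w.1.adicCompletion L) ≠ 0 := fun h => by rw [h, map_zero] at h4v; exact zero_ne_one h4v
  have hϖ0 : ϖ ≠ 0 := fun h => by rw [h, map_zero] at hϖ; exact WithZero.zero_ne_coe hϖ
  have hvϖ0 : Valued.v ϖ ≠ 0 := (Valuation.ne_zero_iff _).2 hϖ0
  have hvpow : ∀ k : ℕ, Valued.v (ϖ ^ k) = WithZero.exp (-(k : ℤ)) := fun k => by
    rw [map_pow, hϖ, ← WithZero.exp_nsmul]; congr 1; simp
  have hvpow0 : ∀ k : ℕ, Valued.v (ϖ ^ k) ≠ 0 := fun k => (Valuation.ne_zero_iff _).2 (pow_ne_zero _ hϖ0)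
  obtain ⟨-, -, -, hres, -⟩ := ramifiedBlock_adicCompletion L v w hw he h2v
  have hvP : Valued.v (toPlace v w (HeckeCharacter.uniformizer ↥(maximalRealSubfield L) v : v.adicCompletion ↥(maximalRealSubfield L))) =
      WithZero.exp (-2 : ℤ) :=
    (valued_toPlace_uniformizer_of_ramified L (IsCMField.complexConj L) (IsCMField.complexConj_ne_one L) w hw he).1
  -- valuations of `c`, `D`, `x := 2u − t`
  set D : w.1.adicCompletion L := t ^ 2 - 4 * δ with hDdef
  set x : w.1.adicCompletion L := 2 * u - t with hxdef
  have hvc : Valued.v c = WithZero.exp (-((2 * m : ℕ) : ℤ)) := by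
    rw [hm, map_pow, hvP, ← WithZero.exp_nsmul]; congr 1; push_cast; ring
  have h4c : 4 * c = x ^ 2 - D := by rw [hc]; exact TypeTwoRamifiedDepth.four_mul_quadratic_eq u t δ
  have hnc : Valued.v c = max (Valued.v (x ^ 2)) (Valued.v D) := by
    rw [← valued_sq_sub_eq_of_not_isSquare L w h2 hD, ← h4c, map_mul, h4v, one_mul]
  have hx2 : Valued.v x ≤ Valued.v (ϖ ^ 2) := by
    have e : x = 2 * (u - 1) - (t - 2) := by rw [hxdef]; ring
    rw [e]
    refine Valuation.map_sub_le _ ?_ ht2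
    rw [map_mul, h2v, one_mul]; exact hu2
  have hϖ2lt : Valued.v (ϖ ^ 2) < 1 := by
    rw [hvpow 2, ← WithZero.exp_zero]; exact WithZero.exp_lt_exp.2 (by norm_num)
  have hx1 : Valued.v x < 1 := lt_of_le_of_lt hx2 hϖ2lt
  have hu1 : Valued.v (u - 1) < 1 := lt_of_le_of_lt hu2 hϖ2lt
  have ht2' : Valued.v (t - 2) < 1 := lt_of_le_of_lt ht2 hϖ2lt
  -- the parity law in the form used twice below: `|x| = |ϖ^{2k}|` ⇒ `|D| = |x|`
  have hparity : ∀ k : ℕ, Valued.v x = Valued.v (ϖ ^ (2 * k)) → Valued.v D = Valued.v x := fun k hk =>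
    TypeTwoRamifiedDepth.valued_trace_sq_sub_four_det_eq_of_valued_map_sub_lt (galAdicCompletionMap (L := L) (IsCMField.complexConj L) hw) h2v
      hu ht hu1 hδ1 ht2' (TypeTwoRamifiedDepth.valued_map_sub_lt_of_valued_eq_pow_two_mul _ hϖ hσϖ hres hk)
  rcases lt_or_ge (Valued.v (ϖ ^ N)) (Valued.v x) with hA | hB
  · -- REGIME B: `|ϖ^N| < |x|`
    have hvx0 : Valued.v x ≠ 0 := ne_of_gt (lt_of_le_of_lt zero_le hA)
    have hx0 : x ≠ 0 := (Valuation.ne_zero_iff _).1 hvx0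
    have hD_lt : Valued.v D < Valued.v (x ^ 2) := by
      rw [hdisc, map_pow, show ((2 * N : ℕ) : ℤ) = 2 * (N : ℤ) by push_cast; ring]
      have e : WithZero.exp (-(2 * (N : ℤ))) = Valued.v (ϖ ^ N) ^ 2 := by
        rw [hvpow, ← WithZero.exp_nsmul]; congr 1; ring
      rw [e]
      exact pow_lt_pow_left₀ hA zero_le two_ne_zero
    have hcx : Valued.v c = Valued.v (x ^ 2) := by rw [hnc, max_eq_left hD_lt.le]
    -- `|x| = exp(−m)`
    have hvx : Valued.v x = Valued.v (ϖ ^ m) := by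
      obtain hj := WithZero.exp_log hvx0
      set j := WithZero.log (Valued.v x) with hjdef
      have h2j : WithZero.exp (-((2 * m : ℕ) : ℤ)) = WithZero.exp (j + j) := by
        rw [← hvc, hcx, map_pow, pow_two, ← hj, WithZero.exp_add]
      have hjm : j = -(m : ℤ) := by
        have := WithZero.exp_injective h2j; push_cast at this; omega
      rw [← hj, hjm, hvpow]
    have hmN : m < N := by
      have h := hA; rw [hvx, hvpow, hvpow] at h
      have := WithZero.exp_lt_exp.1 h; omega
    have hodd : Odd m := by
      rcases Nat.even_or_odd m with ⟨k, hk⟩ | hodd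
      · exfalso
        have hk' : m = 2 * k := by omega
        have hDx := hparity k (by rw [hvx, hk'])
        rw [hdisc, hvx, hvpow] at hDx
        have := WithZero.exp_injective hDx; push_cast at this; omega
      · exact hodd
    have hm3 : 3 ≤ m := by
      have h := hx2; rw [hvx, hvpow, hvpow] at h
      have := WithZero.exp_le_exp.1 h
      obtain ⟨k, hk⟩ := hodd; omega
    -- the sign: `c ≡ (x ∕ 2ϖ^m)²·ϖ^{2m}` to first order, a residue square
    have hvr : Valued.v (x / (2 * ϖ ^ m)) = 1 := by
      rw [map_div₀, map_mul, h2v, one_mul, hvx, div_self (hvpow0 m)]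
    have hrO : x / (2 * ϖ ^ m) ∈ 𝒪[w.1.adicCompletion L] := (v_le_one_iff_mem_integer _).1 hvr.le
    have hE : Valued.v (((⟨x / (2 * ϖ ^ m), hrO⟩ ^ 2 : 𝒪[w.1.adicCompletion L])) : w.1.adicCompletion L) = 1 := by
      push_cast; rw [map_pow, hvr, one_pow]
    have hcE : Valued.v (c - (((⟨x / (2 * ϖ ^ m), hrO⟩ ^ 2 : 𝒪[w.1.adicCompletion L])) : w.1.adicCompletion L) * ϖ ^ (2 * m)) < Valued.v (ϖ ^ (2 * m)) := by
      have e : c - (((⟨x / (2 * ϖ ^ m), hrO⟩ ^ 2 : 𝒪[w.1.adicCompletion L])) : w.1.adicCompletion L) * ϖ ^ (2 * m) = -(D / 4) := by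
        push_cast
        have hc' : c = (x ^ 2 - D) / 4 := by rw [← h4c]; field_simp
        rw [hc']; field_simp; ring
      rw [e, Valuation.map_neg, map_div₀, h4v, div_one, hdisc, hvpow]
      exact WithZero.exp_lt_exp.2 (by push_cast; omega)
    have key := quadraticChar_residue_eq_hilbertSymbol_typeTwo_of_sub_lt L w hw he h2v ϖ hϖ hσϖ hu1 hδ1 _ hE m hcE β hβ
    have hτ : hilbertSymbol (v.adicCompletion ↥(maximalRealSubfield L)) (β : v.adicCompletion ↥(maximalRealSubfield L))
        (algebraMap ↥(maximalRealSubfield L) _ ((cmQuadraticGenerator L : 𝓞 ↥(maximalRealSubfield L)) : ↥(maximalRealSubfield L))) = 1 := by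
      rw [← key, Even.neg_one_pow (hodd.add_one), one_mul, map_pow]
      refine quadraticChar_sq_one' ?_
      rw [Ne, residue_eq_zero_iff_valuation_lt_one, ← v_lt_one_iff_valuation_lt_one]
      change ¬ Valued.v (x / (2 * ϖ ^ m)) < 1
      rw [hvr]; exact lt_irrefl _
    exact ⟨hmN.le, fun _ => ⟨hodd, hm3, hτ, hvx⟩, fun h => absurd h (ne_of_lt hmN)⟩
  · -- REGIMES A ∕ C: `|x| ≤ |ϖ^N|`
    have hx2D : Valued.v (x ^ 2) ≤ Valued.v D := by
      rw [hdisc, map_pow, show ((2 * N : ℕ) : ℤ) = 2 * (N : ℤ) by push_cast; ring]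
      have e : WithZero.exp (-(2 * (N : ℤ))) = Valued.v (ϖ ^ N) ^ 2 := by
        rw [hvpow, ← WithZero.exp_nsmul]; congr 1; ring
      rw [e]
      exact pow_le_pow_left₀ zero_le hB 2
    have hmN : m = N := by
      have h := hnc; rw [max_eq_right hx2D, hvc, hdisc] at h
      have := WithZero.exp_injective h; push_cast at this; omega
    refine ⟨hmN.le, fun h => absurd hmN (ne_of_lt h), fun _ => ⟨hB, fun hEq => ?_, fun hlt hNev => ?_⟩⟩
    · -- `|x| = |ϖ^N|` forces `N` odd
      rcases Nat.even_or_odd N with ⟨k, hk⟩ | hodd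
      · exfalso
        have hk' : N = 2 * k := by omega
        have hDx := hparity k (by rw [hEq, hk'])
        rw [hdisc, hEq, hvpow] at hDx
        have hN0 : N = 0 := by have := WithZero.exp_injective hDx; push_cast at this; omega
        rw [hN0, pow_zero, Valuation.map_one] at hEq
        rw [hEq] at hx1; exact lt_irrefl _ hx1
      · exact hodd
    · -- `|x| < |ϖ^N|`, `N` even: `c ≡ −D∕4` to first order, `D∕ϖ^{2N}` a residue non-square
      set U : w.1.adicCompletion L := D / (4 * ϖ ^ (2 * N)) with hUdef
      have hvU : Valued.v U = 1 := by
        rw [hUdef, map_div₀, map_mul, h4v, one_mul, hdisc, hvpow, div_self]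
        exact WithZero.coe_ne_zero
      have hUO : U ∈ 𝒪[w.1.adicCompletion L] := (v_le_one_iff_mem_integer _).1 hvU.le
      have hnegUO : -U ∈ 𝒪[w.1.adicCompletion L] := neg_mem hUO
      have hE : Valued.v (((⟨-U, hnegUO⟩ : 𝒪[w.1.adicCompletion L])) : w.1.adicCompletion L) = 1 := by
        change Valued.v (-U) = 1; rw [Valuation.map_neg, hvU]
      have hcE : Valued.v (c - (((⟨-U, hnegUO⟩ : 𝒪[w.1.adicCompletion L])) : w.1.adicCompletion L) * ϖ ^ (2 * m)) < Valued.v (ϖ ^ (2 * m)) := by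
        have e : c - (((⟨-U, hnegUO⟩ : 𝒪[w.1.adicCompletion L])) : w.1.adicCompletion L) * ϖ ^ (2 * m) = x ^ 2 / 4 := by
          change c - (-U) * ϖ ^ (2 * m) = x ^ 2 / 4
          have hc' : c = (x ^ 2 - D) / 4 := by rw [← h4c]; field_simp
          rw [hc', hUdef, hmN]; field_simp; ring
        rw [e, map_div₀, h4v, div_one, map_pow, hmN, show 2 * N = N * 2 by ring, pow_mul, map_pow]
        exact pow_lt_pow_left₀ hlt zero_le two_ne_zero
      have key := quadraticChar_residue_eq_hilbertSymbol_typeTwo_of_sub_lt L w hw he h2v ϖ hϖ hσϖ hu1 hδ1 _ hE m hcE β hβ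
      -- `U` is not a square (else `D = U·(2ϖ^N)²` would be)
      have hUns : ¬ IsSquare U := by
        rintro ⟨s, hs⟩
        refine hD ⟨s * (2 * ϖ ^ N), ?_⟩
        have hD' : D = U * (2 * ϖ ^ N) ^ 2 := by
          rw [hUdef]; field_simp; ring
        rw [hD', hs]; ring
      have hres_ns := not_isSquare_residue_of_not_isSquare L w h2 hvU hUns
      have hmev : Even m := by rw [hmN]; exact hNev
      have hEeq : ((-1) ^ (m + 1) * ⟨-U, hnegUO⟩ : 𝒪[w.1.adicCompletion L]) = ⟨U, (v_le_one_iff_mem_integer U).1 hvU.le⟩ := by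
        ext; push_cast; rw [Odd.neg_one_pow (hmev.add_one)]; ring
      rw [hEeq, quadraticChar_neg_one_iff_not_isSquare.2 hres_ns] at key
      exact_mod_cast key.symm

include hw in
/-- From the J0diff binders of a type-(2) `γ_H = (g, u)` at the CM place `w` (`hblk hu2 hirr`): the core's abstract hypotheses hold for `u := u_w`, `t := tr g_w`,
`δ := det g_w`, `c := χ_g(u)_w` (unitarity ★ `conjLocal_finGammaTwo_mul_finGammaTwo`, ★ `galAdicCompletionMap_trace_mul_det_eq`; ★ `eval_finCharpolyTwo_finGammaTwo_apply_eq_quadratic`;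
no root ⇒ discriminant non-square). [cite: Rogawski1990, §4.9 pp. 54–55] -/
theorem typeTwo_depthDictionary_hypotheses (h2 : IsUnit (2 : 𝒪[(w.1.adicCompletion L)]))
    (ϖ : w.1.adicCompletion L) (hϖ : Valued.v ϖ = WithZero.exp (-1 : ℤ))
    ⦃γH : ((cmDatum L 2 (Matrix.of fun i j : Fin 2 => if i.val + j.val + 1 = 2 then (1 : L) else 0)).Local v × (cmDatum L 1 (Matrix.of fun i j : Fin 1 => if i.val + j.val + 1 = 1 then (1 : L) else 0)).Local v)⦄
    (hblk : ∀ i j : Fin 2, Valued.v (((((γH.1.val : GL (Fin 2) (UnitaryGroup.LocalRing L v)).val.map (Pi.evalRingHom (fun w' : PlacesOver L v => w'.1.adicCompletion L) w))) - 1) i j) ≤ Valued.v (ϖ ^ 2))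
    (hirr : ¬ ∃ x : (w.1.adicCompletion L), (((((γH.1.val : GL (Fin 2) (UnitaryGroup.LocalRing L v)).val.map (Pi.evalRingHom (fun w' : PlacesOver L v => w'.1.adicCompletion L) w)))).charpoly).IsRoot x) :
    galAdicCompletionMap (L := L) (IsCMField.complexConj L) hw (finGammaTwo L v γH w) * finGammaTwo L v γH w = 1 ∧
    galAdicCompletionMap (L := L) (IsCMField.complexConj L) hw ((((γH.1.val : GL (Fin 2) (UnitaryGroup.LocalRing L v)).val.map (Pi.evalRingHom (fun w' : PlacesOver L v => w'.1.adicCompletion L) w)))).trace * ((((γH.1.val : GL (Fin 2) (UnitaryGroup.LocalRing L v)).val.map (Pi.evalRingHom (fun w' : PlacesOver L v => w'.1.adicCompletion L) w)))).det = ((((γH.1.val : GL (Fin 2) (UnitaryGroup.LocalRing L v)).val.map (Pi.evalRingHom (fun w' : PlacesOver L v => w'.1.adicCompletion L) w)))).trace ∧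
    Valued.v (((((γH.1.val : GL (Fin 2) (UnitaryGroup.LocalRing L v)).val.map (Pi.evalRingHom (fun w' : PlacesOver L v => w'.1.adicCompletion L) w)))).trace - 2) ≤ Valued.v (ϖ ^ 2) ∧ Valued.v (((((γH.1.val : GL (Fin 2) (UnitaryGroup.LocalRing L v)).val.map (Pi.evalRingHom (fun w' : PlacesOver L v => w'.1.adicCompletion L) w)))).det - 1) < 1 ∧
    ((finCharpolyTwo L v γH).eval (finGammaTwo L v γH)) w = finGammaTwo L v γH w ^ 2 - ((((γH.1.val : GL (Fin 2) (UnitaryGroup.LocalRing L v)).val.map (Pi.evalRingHom (fun w' : PlacesOver L v => w'.1.adicCompletion L) w)))).trace * finGammaTwo L v γH w + ((((γH.1.val : GL (Fin 2) (UnitaryGroup.LocalRing L v)).val.map (Pi.evalRingHom (fun w' : PlacesOver L v => w'.1.adicCompletion L) w)))).det ∧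
    ¬ IsSquare (((((γH.1.val : GL (Fin 2) (UnitaryGroup.LocalRing L v)).val.map (Pi.evalRingHom (fun w' : PlacesOver L v => w'.1.adicCompletion L) w)))).trace ^ 2 - 4 * ((((γH.1.val : GL (Fin 2) (UnitaryGroup.LocalRing L v)).val.map (Pi.evalRingHom (fun w' : PlacesOver L v => w'.1.adicCompletion L) w)))).det) := by
  have h2v : Valued.v (2 : w.1.adicCompletion L) = 1 := (isUnit_two_integer_iff_valued_eq_one L w.1).1 h2
  have h20 : (2 : w.1.adicCompletion L) ≠ 0 := fun h => by rw [h, map_zero] at h2v; exact zero_ne_one h2v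
  set g : Matrix (Fin 2) (Fin 2) (w.1.adicCompletion L) := (((γH.1.val : GL (Fin 2) (UnitaryGroup.LocalRing L v)).val.map (Pi.evalRingHom (fun w' : PlacesOver L v => w'.1.adicCompletion L) w))) with hgdef
  have hu : galAdicCompletionMap (L := L) (IsCMField.complexConj L) hw (finGammaTwo L v γH w) * finGammaTwo L v γH w = 1 := by
    have h := congrArg (fun y : LocalRing L v => y w) (conjLocal_finGammaTwo_mul_finGammaTwo L v γH)
    simpa only [Pi.mul_apply, Pi.one_apply, conjLocal_apply_eq_galAdicCompletionMap L v w hw] using h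
  have hϖ2lt : Valued.v (ϖ ^ 2) < 1 := by
    rw [map_pow, hϖ, ← WithZero.exp_nsmul, ← WithZero.exp_zero]; exact WithZero.exp_lt_exp.2 (by norm_num)
  have hent : ∀ i j : Fin 2, Valued.v ((g - 1) i j) < 1 := fun i j => lt_of_le_of_lt (hblk i j) hϖ2lt
  have htr : g.trace - 2 = (g - 1) 0 0 + (g - 1) 1 1 := by
    rw [Matrix.trace_fin_two, Matrix.sub_apply, Matrix.sub_apply, Matrix.one_apply_eq, Matrix.one_apply_eq]; ring
  have hdet : g.det - 1 = (g - 1) 0 0 * (g - 1) 1 1 + (g - 1) 0 0 + (g - 1) 1 1 - (g - 1) 0 1 * (g - 1) 1 0 := by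
    rw [Matrix.det_fin_two, Matrix.sub_apply, Matrix.sub_apply, Matrix.sub_apply, Matrix.sub_apply, Matrix.one_apply_eq, Matrix.one_apply_eq,
      Matrix.one_apply_ne (by decide : (0 : Fin 2) ≠ 1), Matrix.one_apply_ne (by decide : (1 : Fin 2) ≠ 0)]; ring
  refine ⟨hu, galAdicCompletionMap_trace_mul_det_eq L v w hw γH, ?_, ?_, eval_finCharpolyTwo_finGammaTwo_apply_eq_quadratic L v w γH,
    TypeTwoRamifiedDepth.not_isSquare_trace_sq_sub_four_det_of_not_exists_isRoot h20 g hirr⟩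
  · rw [htr]; exact Valuation.map_add_le _ (hblk 0 0) (hblk 1 1)
  · rw [hdet]
    have hmul : ∀ a b : w.1.adicCompletion L, Valued.v a < 1 → Valued.v b < 1 → Valued.v (a * b) < 1 := fun a b ha hb => by
      rw [map_mul]; exact mul_lt_one_of_lt_of_le ha hb.le
    refine Valuation.map_sub_lt _ (Valuation.map_add_lt _ (Valuation.map_add_lt _ (hmul _ _ (hent 0 0) (hent 1 1)) (hent 0 0)) (hent 1 1)) ?_
    exact hmul _ _ (hent 0 1) (hent 1 0)

include hw in
/-- **THE DEPTH DICTIONARY, EVEN DISCRIMINANT DEPTH `N = 2n`** (the `stub_mdict_even` of the (α) v1 block-law skeleton), binders = the J0diff's `hblk hu2 hirr hdisc hm hβ`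
VERBATIM (`hn : 1 ≤ n` is not needed): **`m ≤ 2n`**; **regime B** `m < 2n ⇒ Odd m ∧ 3 ≤ m ∧ (β,θ)_v = 1 ∧ |2u_w − tr g_w|_w = |ϖ^m|`; **regime A-even** `m = 2n ⇒ (β,θ)_v = −1 ∧ |2u_w − tr g_w|_w < |ϖ^(2n)|`.
[cite: Rogawski1990, §4.9 pp. 55, 59, Prop. 4.9.1 (b)] [cite: LabesseLanglands1979, §2 pp. 8–9] [cite: Serre1979, Ch. V §3 Cor. 2] -/
theorem typeTwo_depthDictionary_even_ram (he : v.asIdeal.ramificationIdx' w.1.asIdeal ≠ 1) (h2 : IsUnit (2 : 𝒪[(w.1.adicCompletion L)]))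
    (ϖ : w.1.adicCompletion L) (hϖ : Valued.v ϖ = WithZero.exp (-1 : ℤ)) (hσϖ : galAdicCompletionMap (L := L) (IsCMField.complexConj L) hw ϖ = -ϖ)
    ⦃γH : ((cmDatum L 2 (Matrix.of fun i j : Fin 2 => if i.val + j.val + 1 = 2 then (1 : L) else 0)).Local v × (cmDatum L 1 (Matrix.of fun i j : Fin 1 => if i.val + j.val + 1 = 1 then (1 : L) else 0)).Local v)⦄
    (hblk : ∀ i j : Fin 2, Valued.v (((((γH.1.val : GL (Fin 2) (UnitaryGroup.LocalRing L v)).val.map (Pi.evalRingHom (fun w' : PlacesOver L v => w'.1.adicCompletion L) w))) - 1) i j) ≤ Valued.v (ϖ ^ 2)) (hu2 : Valued.v (finGammaTwo L v γH w - 1) ≤ Valued.v (ϖ ^ 2))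
    (hirr : ¬ ∃ x : (w.1.adicCompletion L), (((((γH.1.val : GL (Fin 2) (UnitaryGroup.LocalRing L v)).val.map (Pi.evalRingHom (fun w' : PlacesOver L v => w'.1.adicCompletion L) w)))).charpoly).IsRoot x) ⦃n : ℕ⦄
    (hdisc : Valued.v (((((γH.1.val : GL (Fin 2) (UnitaryGroup.LocalRing L v)).val.map (Pi.evalRingHom (fun w' : PlacesOver L v => w'.1.adicCompletion L) w)))).trace ^ 2 - 4 * ((((γH.1.val : GL (Fin 2) (UnitaryGroup.LocalRing L v)).val.map (Pi.evalRingHom (fun w' : PlacesOver L v => w'.1.adicCompletion L) w)))).det) = WithZero.exp (-((2 * (2 * n) : ℕ) : ℤ)))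
    (m : ℕ) (hm : Valued.v (((finCharpolyTwo L v γH).eval (finGammaTwo L v γH)) w) = Valued.v ((toPlace v w (HeckeCharacter.uniformizer ↥(maximalRealSubfield L) v : v.adicCompletion ↥(maximalRealSubfield L))) ^ m))
    (β : (v.adicCompletion ↥(maximalRealSubfield L))ˣ)
    (hβ : toPlace v w (β : v.adicCompletion ↥(maximalRealSubfield L)) =
      -(((finCharpolyTwo L v γH).eval (finGammaTwo L v γH)) w * (finGammaTwo L v γH w ^ 2 + ((γH.1.val.val : Matrix (Fin 2) (Fin 2) (LocalRing L v)).map (Pi.evalRingHom (fun w' : PlacesOver L v => w'.1.adicCompletion L) w)).det)) / (2 * finGammaTwo L v γH w ^ 2 * ((γH.1.val.val : Matrix (Fin 2) (Fin 2) (LocalRing L v)).map (Pi.evalRingHom (fun w' : PlacesOver L v => w'.1.adicCompletion L) w)).det)) :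
    m ≤ 2 * n ∧
    (m < 2 * n → Odd m ∧ 3 ≤ m ∧
      hilbertSymbol (v.adicCompletion ↥(maximalRealSubfield L)) (β : v.adicCompletion ↥(maximalRealSubfield L))
          (algebraMap ↥(maximalRealSubfield L) _ ((cmQuadraticGenerator L : 𝓞 ↥(maximalRealSubfield L)) : ↥(maximalRealSubfield L))) = 1 ∧
      Valued.v (2 * finGammaTwo L v γH w - ((((γH.1.val : GL (Fin 2) (UnitaryGroup.LocalRing L v)).val.map (Pi.evalRingHom (fun w' : PlacesOver L v => w'.1.adicCompletion L) w)))).trace) = Valued.v (ϖ ^ m)) ∧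
    (m = 2 * n →
      hilbertSymbol (v.adicCompletion ↥(maximalRealSubfield L)) (β : v.adicCompletion ↥(maximalRealSubfield L))
          (algebraMap ↥(maximalRealSubfield L) _ ((cmQuadraticGenerator L : 𝓞 ↥(maximalRealSubfield L)) : ↥(maximalRealSubfield L))) = -1 ∧
      Valued.v (2 * finGammaTwo L v γH w - ((((γH.1.val : GL (Fin 2) (UnitaryGroup.LocalRing L v)).val.map (Pi.evalRingHom (fun w' : PlacesOver L v => w'.1.adicCompletion L) w)))).trace) < Valued.v (ϖ ^ (2 * n))) := by
  obtain ⟨hu, ht, ht2, hδ1, hc, hD⟩ := typeTwo_depthDictionary_hypotheses L w hw h2 ϖ hϖ hblk hirr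
  obtain ⟨hle, hB, hA⟩ := typeTwo_depthDictionary_core L w hw he h2 ϖ hϖ hσϖ hu ht hu2 ht2 hδ1 hc hD hdisc m hm β hβ
  refine ⟨hle, hB, fun hmN => ?_⟩
  obtain ⟨hxle, hxeq, hτ⟩ := hA hmN
  have hlt : Valued.v (2 * finGammaTwo L v γH w - ((((γH.1.val : GL (Fin 2) (UnitaryGroup.LocalRing L v)).val.map (Pi.evalRingHom (fun w' : PlacesOver L v => w'.1.adicCompletion L) w)))).trace) < Valued.v (ϖ ^ (2 * n)) :=
    lt_of_le_of_ne hxle fun h => (Nat.not_odd_iff_even.2 (even_two_mul n)) (hxeq h)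
  exact ⟨hτ hlt (even_two_mul n), hlt⟩

include hw in
/-- **THE DEPTH DICTIONARY, ODD DISCRIMINANT DEPTH `N = 2n+1`** (the `stub_mdict_odd`): **`m ≤ 2n+1`**; **regime B** `m < 2n+1 ⇒ Odd m ∧ 3 ≤ m ∧ (β,θ)_v = 1 ∧
|2u_w − tr g_w|_w = |ϖ^m|`; **regimes A-odd ∕ C** `m = 2n+1 ⇒ (β,θ)_v ∈ {1, −1} ∧ |2u_w − tr g_w|_w ≤ |ϖ^(2n+1)|` (the sign is residue-dependent there, ★ (z5) p848151∕p848205).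
[cite: Rogawski1990, §4.9 pp. 55, 59, Prop. 4.9.1 (b)] [cite: LabesseLanglands1979, §2 pp. 8–9] [cite: Serre1979, Ch. V §3 Cor. 2] -/
theorem typeTwo_depthDictionary_odd_ram (he : v.asIdeal.ramificationIdx' w.1.asIdeal ≠ 1) (h2 : IsUnit (2 : 𝒪[(w.1.adicCompletion L)]))
    (ϖ : w.1.adicCompletion L) (hϖ : Valued.v ϖ = WithZero.exp (-1 : ℤ)) (hσϖ : galAdicCompletionMap (L := L) (IsCMField.complexConj L) hw ϖ = -ϖ)
    ⦃γH : ((cmDatum L 2 (Matrix.of fun i j : Fin 2 => if i.val + j.val + 1 = 2 then (1 : L) else 0)).Local v × (cmDatum L 1 (Matrix.of fun i j : Fin 1 => if i.val + j.val + 1 = 1 then (1 : L) else 0)).Local v)⦄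
    (hblk : ∀ i j : Fin 2, Valued.v (((((γH.1.val : GL (Fin 2) (UnitaryGroup.LocalRing L v)).val.map (Pi.evalRingHom (fun w' : PlacesOver L v => w'.1.adicCompletion L) w))) - 1) i j) ≤ Valued.v (ϖ ^ 2)) (hu2 : Valued.v (finGammaTwo L v γH w - 1) ≤ Valued.v (ϖ ^ 2))
    (hirr : ¬ ∃ x : (w.1.adicCompletion L), (((((γH.1.val : GL (Fin 2) (UnitaryGroup.LocalRing L v)).val.map (Pi.evalRingHom (fun w' : PlacesOver L v => w'.1.adicCompletion L) w)))).charpoly).IsRoot x) ⦃n : ℕ⦄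
    (hdisc : Valued.v (((((γH.1.val : GL (Fin 2) (UnitaryGroup.LocalRing L v)).val.map (Pi.evalRingHom (fun w' : PlacesOver L v => w'.1.adicCompletion L) w)))).trace ^ 2 - 4 * ((((γH.1.val : GL (Fin 2) (UnitaryGroup.LocalRing L v)).val.map (Pi.evalRingHom (fun w' : PlacesOver L v => w'.1.adicCompletion L) w)))).det) = WithZero.exp (-((2 * (2 * n + 1) : ℕ) : ℤ)))
    (m : ℕ) (hm : Valued.v (((finCharpolyTwo L v γH).eval (finGammaTwo L v γH)) w) = Valued.v ((toPlace v w (HeckeCharacter.uniformizer ↥(maximalRealSubfield L) v : v.adicCompletion ↥(maximalRealSubfield L))) ^ m))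
    (β : (v.adicCompletion ↥(maximalRealSubfield L))ˣ)
    (hβ : toPlace v w (β : v.adicCompletion ↥(maximalRealSubfield L)) =
      -(((finCharpolyTwo L v γH).eval (finGammaTwo L v γH)) w * (finGammaTwo L v γH w ^ 2 + ((γH.1.val.val : Matrix (Fin 2) (Fin 2) (LocalRing L v)).map (Pi.evalRingHom (fun w' : PlacesOver L v => w'.1.adicCompletion L) w)).det)) / (2 * finGammaTwo L v γH w ^ 2 * ((γH.1.val.val : Matrix (Fin 2) (Fin 2) (LocalRing L v)).map (Pi.evalRingHom (fun w' : PlacesOver L v => w'.1.adicCompletion L) w)).det)) :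
    m ≤ 2 * n + 1 ∧
    (m < 2 * n + 1 → Odd m ∧ 3 ≤ m ∧
      hilbertSymbol (v.adicCompletion ↥(maximalRealSubfield L)) (β : v.adicCompletion ↥(maximalRealSubfield L))
          (algebraMap ↥(maximalRealSubfield L) _ ((cmQuadraticGenerator L : 𝓞 ↥(maximalRealSubfield L)) : ↥(maximalRealSubfield L))) = 1 ∧
      Valued.v (2 * finGammaTwo L v γH w - ((((γH.1.val : GL (Fin 2) (UnitaryGroup.LocalRing L v)).val.map (Pi.evalRingHom (fun w' : PlacesOver L v => w'.1.adicCompletion L) w)))).trace) = Valued.v (ϖ ^ m)) ∧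
    (m = 2 * n + 1 →
      (hilbertSymbol (v.adicCompletion ↥(maximalRealSubfield L)) (β : v.adicCompletion ↥(maximalRealSubfield L))
          (algebraMap ↥(maximalRealSubfield L) _ ((cmQuadraticGenerator L : 𝓞 ↥(maximalRealSubfield L)) : ↥(maximalRealSubfield L))) = 1 ∨
       hilbertSymbol (v.adicCompletion ↥(maximalRealSubfield L)) (β : v.adicCompletion ↥(maximalRealSubfield L))
          (algebraMap ↥(maximalRealSubfield L) _ ((cmQuadraticGenerator L : 𝓞 ↥(maximalRealSubfield L)) : ↥(maximalRealSubfield L))) = -1) ∧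
      Valued.v (2 * finGammaTwo L v γH w - ((((γH.1.val : GL (Fin 2) (UnitaryGroup.LocalRing L v)).val.map (Pi.evalRingHom (fun w' : PlacesOver L v => w'.1.adicCompletion L) w)))).trace) ≤ Valued.v (ϖ ^ (2 * n + 1))) := by
  obtain ⟨hu, ht, ht2, hδ1, hc, hD⟩ := typeTwo_depthDictionary_hypotheses L w hw h2 ϖ hϖ hblk hirr
  obtain ⟨hle, hB, hA⟩ := typeTwo_depthDictionary_core L w hw he h2 ϖ hϖ hσϖ hu ht hu2 ht2 hδ1 hc hD hdisc m hm β hβ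
  refine ⟨hle, hB, fun hmN => ⟨?_, (hA hmN).1⟩⟩
  have hβ0 : (β : v.adicCompletion ↥(maximalRealSubfield L)) ≠ 0 := β.ne_zero
  by_cases hN : ∃ z : w.1.adicCompletion L, galAdicCompletionMap (L := L) (IsCMField.complexConj L) hw z * z = toPlace v w (β : v.adicCompletion ↥(maximalRealSubfield L))
  · exact Or.inl ((hilbertSymbol_eq_one_iff_exists_norm_toPlace L v w hw hβ0).2 hN)
  · exact Or.inr ((hilbertSymbol_eq_neg_one_iff_not_exists_norm_toPlace L v w hw hβ0).2 hN)

end Dictionary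

end Literature.NumberTheory.Rogawski1990

end
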